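import Literature.NumberTheory.PAdicHodge.BmaxPlusTransportedLegendre
import Literature.NumberTheory.PAdicHodge.BmaxPlusPhiRoadReciprocity
import HarnessLib

/-!
# Kato's reciprocity law modulo (K₂) with the TRANSPORTED period maps of a ramified good model `W_D ≡ E₀ (mod ϖ)`:
# the capstone with the Hodge pair `Pω″ = A·P⁰ + B·Q⁰`, `Pη″ = C·P⁰ + C′·Q⁰` — the ramified scalars cancel

Topic `Literature/NumberTheory/PAdicHodge`; THEOREMS ONLY (no definition, no named fact, no instance, no `sorry`). The ramified-cell twin of
`BmaxPlusPhiRoadReciprocity` (there: good supersingular `ℤ`-models, torsion towers, `Pω = f∘Λ`, `Pη = f∘φ∘Λ`). Brick T5 of memos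
`Summits/BirchSwinnertonDyer/BirchSwinnertonDyer/Cruxes/StarredOptimalManinUnitFiveSeven/Lines/kato-lever-K2-transported-period-hom.md` §2 and
`…/kato-lever-K2-ramified-cm-transport.md` §10.1–§10.2 (line `kato_lever`, crux K★ `stmt-BirchSwinnertonDyer-22226`).

Setting: `F = K_v`, `D` an Eisenstein datum (`𝒪_D = ℤ_p[ϖ] ⊆ 𝒪_F`), `W = W_D` a Weierstrass equation over `𝒪_D` congruent modulo `ϖ` to `E₀/ℤ`
(`E₀ ⊗ ℚ_p`, `E₀ ⊗ 𝔽_p` elliptic), `T_pŴ_D = AinfTop.TatePtO F (W ⊗_ψ 𝒪_F) p`, and the HONEST transported period maps of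
`BmaxPlusTransportedPeriodHomsBdR.exists_transported_periodHoms`: `LT : T_pŴ_D →+ A_max` (`LT τ = Λ_N(ι[T(τ)~], z)` for every CM-fibre transport
and every witness), `P⁰ = f∘LT`, `Q⁰ = f∘φ∘LT : T_pŴ_D →+ B_dR⁺` (`f = bmaxPlusToBdR`), `ℤ_p`-linear and `Γ_F`-equivariant (hypotheses
`hLT hP₀ hQ₀ hP₀Z hQ₀Z hP₀g hQ₀g`, obtained from that theorem). For scalars `A, B, C, C′ ∈ F` (`(A, B)` = the transported Hodge line of
`TransportedHodgeLine`, `(C, C′) ∈ {(B⁻¹, 0), (0, −A⁻¹)}` per branch) the cells' period pair is the recombination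
`Pω″ = ι(A)·P⁰ + ι(B)·Q⁰`, `Pη″ = ι(C)·P⁰ + ι(C′)·Q⁰` (`ι = embBdRHom : F ↪ B_dR⁺`).

* §1 `hodgePair_det_eq`, `hodgePair_resolution_eq` — the `2 × 2` bookkeeping: `Pω″ ∧ Pη″ = (AC′ − BC)·(P⁰ ∧ Q⁰)` and
  `Pη″(a)·b″_ω − Pω″(a)·b″_η = (AC′ − BC)·(Q⁰(a)·b⁰_ω − P⁰(a)·b⁰_η)` for the recombined integrating pair `b″_ω = ι(A)b⁰_ω + ι(B)b⁰_η`,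
  `b″_η = ι(C)b⁰_ω + ι(C′)b⁰_η`; `thetaBdR_hodgeLine_of_filOne` — `Pω″ ⊆ Fil¹` reads `A·θ(P⁰τ) + B·θ(Q⁰τ) = 0` in `ℂ_F`.
* §2 ★★★ `exists_const_tatePairingPoint_eq_neg_trace_of_KTwo_transported_of_matching` — along an abstract equivariant matching
  `em : T_pW ≃ T_pŴ_D` (`W/K₀` elliptic, `K₀ ⊆ F`), GIVEN `Pω″ ⊆ Fil¹`, `Pω″ ≢ 0`, `Pη″ ⊄ Fil¹` and `(A, B) ≠ 0`: ONE pair `(c_L ≠ 0, c)` with the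
  Legendre relation such that for every `η`, every `P` with `T`-adic Kummer cocycle `κ`, every CRYSTALLINE integrating pair `(b⁰_ω, b⁰_η)` of `κ`
  for the pull-backs `(P₁, Q₁) = (P⁰∘em, Q⁰∘em)` with `θ(ι(A)b⁰_ω + ι(B)b⁰_η) = c_P` and every `ℤ_p`-basis `b` of `T_pW`:
  **(K₂) in the transported `c_L`-FREE crystalline form `∀ i, ∃ M, IsTeichLog 2 (p^M·(Q₁(bᵢ)·b⁰_ω − P₁(bᵢ)·b⁰_η))`
  ⟹ `⟨[η], P⟩ = −Tr_{F/ℚ_p}(c_P · exp*_d(η) · c)`.** Inside: `Pω″ ⊆ Fil¹` with `(A,B) ≠ 0` gives `θ(P⁰S·Q⁰U − Q⁰S·P⁰U) = 0`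
  (`thetaBdR_transported_det_eq_zero_of_hodgeLine`), Fontaine's lemma gives `p^k·(P⁰∧Q⁰)(S,U) = c·t` with `c ∈ ℤ_p`
  (`exists_pow_mul_transported_det_eq_tBdR`), and comparing with the capstone's Legendre relation at a Weil-nondegenerate pair yields
  **`ι(c_L⁻¹·(AC′ − BC)) ∈ ℚ_p`** — the ramified scalars CANCEL against `c_L`, so the crystalline (K₂) (which `isTeichLog_transported_resolution`
  PROVES for the integrating pair `(fΛ_{Tu}, fφΛ_{Tu})` of a Kummer tower) is the capstone's rescaled basis form up to a `p`-power.

What is NOT supplied here (the cell data of the successor's instantiation, memo §10.2 steps 2–3): the canonical matching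
`em = θ_∞ ≫ tateGeomEquivTatePtOSS`, the transported Kummer identity (`transported_integrating_pair`), `θ(b″_ω) = p^N·log_{W_D}(P)`
(`AinfRamTop.thetaBdR_transportedHodgeCombination_eq`), `Pω″ ⊆ Fil¹` (T2c on torsion towers + the Hodge line), `hne`/`hnot` per branch
(`transported_P₀_ne_zero`, non-degeneracy). HONEST LIMITS: BSD / K★ (`stmt-BirchSwinnertonDyer-22226`) / [REC] are NOT proved by this file.

## References
* K. Kato, LNM 1553 (1993), Ch. II Thm. 1.4.1, Lemma 1.4.3. [Kato1993LNM1553]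
* P. Colmez, Math. Ann. 292 (1992), §2 (Legendre relation). [Colmez1992PeriodesAbeliennes]
* J.-M. Fontaine, Astérisque 223 (1994), Exp. II §1.5.3, Exp. III Th. 5.3.7. [FontaineAsterisque223III]
* N. M. Katz, *Crystalline cohomology, Dieudonné modules, and Jacobi sums* (1981), Thm. 5.1.4–5.1.5. [Katz1981CrystallineDieudonne]
-/

noncomputable section

open Field Function ValuativeRel WittVector NumberField IsDedekindDomain
open scoped NumberField Topology

namespace Literature.NumberTheory.PAdicHodge

open Literature.NumberTheory.GaloisRepresentations
open Literature.NumberTheory.GaloisRepresentations.IsNonarchimedeanLocalField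
open Literature.NumberTheory.GaloisRepresentations.LubinTate
open Literature.NumberTheory.GaloisCohomology
open Literature.NumberTheory.EllipticCurves
open Literature.NumberTheory.PAdicHodge.GaloisContinuity
open Literature.IUT.LogVolume
open Literature.RingTheory.FormalGroups Literature.AlgebraicGeometry.Resolution
open _root_.WeierstrassCurve

/-! ### §1 The `2 × 2` bookkeeping of the recombined Hodge pair -/

section General

variable {F : Type} [Field F] [ValuativeRel F] [TopologicalSpace F] [IsNonarchimedeanLocalField F]
  [CharZero F] {p : ℕ} [Fact p.Prime] [Fact (¬ IsUnit (p : integerC F))]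
  [IsAdicComplete (Ideal.span {(p : integerC F)}) (integerC F)]

omit [CharZero F] in
/-- **Legendre determinant of the recombined pair**: for `Pω″ = A·P⁰ + B·Q⁰`, `Pη″ = C·P⁰ + C′·Q⁰` (pointwise, any scalars of the commutative
ring `B_dR⁺`), `Pω″(a)·Pη″(U) − Pη″(a)·Pω″(U) = (AC′ − BC)·(P⁰(a)·Q⁰(U) − Q⁰(a)·P⁰(U))`. [cite: Colmez1992PeriodesAbeliennes, §2] -/
theorem hodgePair_det_eq {T : Type*} (P₀ Q₀ Pω Pη : T → BdRPlusTop F p) (A B C C' : BdRPlusTop F p)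
    (hPω : ∀ τ, Pω τ = A * P₀ τ + B * Q₀ τ) (hPη : ∀ τ, Pη τ = C * P₀ τ + C' * Q₀ τ) (a U : T) :
    Pω a * Pη U - Pη a * Pω U = (A * C' - B * C) * (P₀ a * Q₀ U - Q₀ a * P₀ U) := by
  rw [hPω, hPω, hPη, hPη]; ring

omit [CharZero F] in
/-- **Legendre resolution of the recombined pair**: with the recombined integrating pair `b″_ω = A·b⁰_ω + B·b⁰_η`, `b″_η = C·b⁰_ω + C′·b⁰_η`,
`Pη″(a)·b″_ω − Pω″(a)·b″_η = (AC′ − BC)·(Q⁰(a)·b⁰_ω − P⁰(a)·b⁰_η)`. [cite: Kato1993LNM1553, Ch. II §1.4] [cite: Colmez1992PeriodesAbeliennes, §2] -/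
theorem hodgePair_resolution_eq {T : Type*} (P₀ Q₀ Pω Pη : T → BdRPlusTop F p) (A B C C' : BdRPlusTop F p)
    (hPω : ∀ τ, Pω τ = A * P₀ τ + B * Q₀ τ) (hPη : ∀ τ, Pη τ = C * P₀ τ + C' * Q₀ τ) (bω bη : BdRPlusTop F p) (a : T) :
    Pη a * (A * bω + B * bη) - Pω a * (C * bω + C' * bη) = (A * C' - B * C) * (Q₀ a * bω - P₀ a * bη) := by
  rw [hPω, hPη]; ring

/-- **`Pω″ ⊆ Fil¹` reads `A·θ(P⁰τ) + B·θ(Q⁰τ) = 0` in `ℂ_F`** (`θ ∘ ι = (F ⊆ ℂ_F)` for `ι = embBdRHom`, `Fil¹ = ker θ`).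
[cite: FontaineAsterisque223III, Exp. II §1.5.3–1.5.4] -/
theorem thetaBdR_hodgeLine_of_filOne (hp : valuation F p < 1) (hF : Function.Surjective (fontaineTheta (integerC F) p))
    {T : Type*} (P₀ Q₀ Pω : T → BdRPlusTop F p) (A B : F)
    (hPω : ∀ τ, Pω τ = BdRPlusTop.of F p (embBdRHom hp hF A) * P₀ τ + BdRPlusTop.of F p (embBdRHom hp hF B) * Q₀ τ)
    (hfil : ∀ τ, Pω τ ∈ (BdRPlusTop.filOne F p).toIdeal) (τ : T) :
    algebraMap F (CompletedAlgClosure F) A * thetaBdR ((BdRPlusTop.of F p).symm (P₀ τ)) +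
      algebraMap F (CompletedAlgClosure F) B * thetaBdR ((BdRPlusTop.of F p).symm (Q₀ τ)) = 0 := by
  have h := thetaBdR_eq_zero_of_mem_span (BdRPlusTop.mem_filOne_iff.1 (hfil τ))
  rw [hPω, map_add, map_mul, map_mul, RingEquiv.symm_apply_apply, RingEquiv.symm_apply_apply, map_add, map_mul, map_mul,
    thetaBdR_embBdRHom, thetaBdR_embBdRHom] at h
  exact h

end General

/-! ### §2 The capstone with the transported Hodge pair along an abstract matching -/

section Completion

variable {K : Type} [Field K] [NumberField K] {p : ℕ} [hprime : Fact p.Prime] (v : HeightOneSpectrum (𝓞 K))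
  [CharZero (v.adicCompletion K)] [LocallyCompactSpace (absoluteGaloisGroup (v.adicCompletion K))]
  [Fact (¬ IsUnit (p : integerC (v.adicCompletion K)))]
  [IsAdicComplete (Ideal.span {(p : integerC (v.adicCompletion K))}) (integerC (v.adicCompletion K))]
  {K₀ : Type} [Field K₀] [CharZero K₀] (W : WeierstrassCurve K₀) [W.IsElliptic] [Algebra K₀ (v.adicCompletion K)]
  (e : (k : ℕ) → geomTorsion W ((p ^ k : ℕ) : ℤ) → geomTorsion W ((p ^ k : ℕ) : ℤ) → AlgebraicClosure K₀)
  (hμ : ∀ k S T, e k S T ^ (p ^ k) = 1) (hadd₁ : ∀ k S₁ S₂ T, e k (S₁ + S₂) T = e k S₁ T * e k S₂ T)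
  (hadd₂ : ∀ k S T₁ T₂, e k S (T₁ + T₂) = e k S T₁ * e k S T₂)
  (hgal : ∀ k (σ : absoluteGaloisGroup K₀) (S T : geomTorsion W ((p ^ k : ℕ) : ℤ)), σ • e k S T = e k (σ • S) (σ • T))
  (hcompat : ∀ k (S T : geomTorsion W ((p ^ (k + 1) : ℕ) : ℤ)),
    e k (torsionMulHom W (p ^ (k + 1)) (p ^ k) p (pow_succ p k).symm S)
      (torsionMulHom W (p ^ (k + 1)) (p ^ k) p (pow_succ p k).symm T) = e (k + 1) S T ^ p)

set_option maxHeartbeats 4800000 in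
include hgal in
/-- ★★★ **Kato's reciprocity law at a completion with the TRANSPORTED period maps of a ramified good model, modulo (K₂) in the transported
`c_L`-free crystalline form.** `F = K_v`; `D` an Eisenstein datum, `Wm/𝒪_D` congruent mod `ϖ` to `E₀/ℤ` (`E₀ ⊗ ℚ_p`, `E₀ ⊗ 𝔽_p` elliptic),
`ψm : 𝒪_D → 𝒪_F` the structure map; `W/K₀` (`K₀ ⊆ F`) with an equivariant matching `em : T_pW ≃ T_pŴ_D`; `(LT, P⁰, Q⁰)` the transported period
maps with their specification (`hLT hP₀ hQ₀ hP₀Z hQ₀Z hP₀g hQ₀g`, from `exists_transported_periodHoms`, `N ≥ e`); scalars `A B C C′ ∈ F` with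
`(A, B) ≠ 0` and the recombined pair `Pω″ = ι(A)P⁰ + ι(B)Q⁰ ⊆ Fil¹`, `Pω″ ≢ 0`, `Pη″ = ι(C)P⁰ + ι(C′)Q⁰ ⊄ Fil¹`. Then with `Pω := Pω″∘em`,
`Pη := Pη″∘em` and the pulled-back crystalline maps `P₁ := P⁰∘em`, `Q₁ := Q⁰∘em` there is ONE pair `(c_L ≠ 0, c)` with the Legendre relation
such that for every `η`, every `P` with `T`-adic Kummer cocycle `κ`, every pair `(b⁰_ω, b⁰_η)` integrating `(P₁∘κ, Q₁∘κ)` with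
`θ(ι(A)b⁰_ω + ι(B)b⁰_η) = c_P`, and every `ℤ_p`-basis `b` of `T_pW`:
**`(∀ i, ∃ M, IsTeichLog 2 (p^M·(Q₁(bᵢ)·b⁰_ω − P₁(bᵢ)·b⁰_η))) ⟹ ⟨[η], P⟩ = −Tr_{F/ℚ_p}(c_P · exp*_d(η) · c)`.**
The ramified scalars cancel: `ι(c_L⁻¹(AC′ − BC)) ∈ ℚ_p` by Fontaine's lemma on the transported Legendre determinant (`θ = 0` from `Pω″ ⊆ Fil¹`).
[cite: Kato1993LNM1553, Ch. II Thm. 1.4.1 (3)–(4) and Lemma 1.4.3] [cite: Colmez1992PeriodesAbeliennes, §2]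
[cite: FontaineAsterisque223III, Exp. II §1.5.3, Exp. III Th. 5.3.7] [cite: Katz1981CrystallineDieudonne, Thm. 5.1.4–5.1.5] -/
theorem exists_const_tatePairingPoint_eq_neg_trace_of_KTwo_transported_of_matching
    (hpv : valuation (v.adicCompletion K) (p : v.adicCompletion K) < 1)
    (Dv : EisensteinRoot (v.adicCompletion K) p hpv) (Wm : WeierstrassCurve (EisensteinRoot.CoeffDisc Dv)) (E₀ : WeierstrassCurve ℤ)
    (hWE : Wm.map (Ideal.Quotient.mk (Ideal.span {EisensteinRoot.CoeffDisc.of Dv (AdjoinRoot.root Dv.poly)})) =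
      (E₀.map (algebraMap ℤ (EisensteinRoot.CoeffDisc Dv))).map
        (Ideal.Quotient.mk (Ideal.span {EisensteinRoot.CoeffDisc.of Dv (AdjoinRoot.root Dv.poly)})))
    (ψm : EisensteinRoot.CoeffDisc Dv →+* LTCoeff (v.adicCompletion K))
    (hψm : ∀ c, algebraMap (LTCoeff (v.adicCompletion K)) (v.adicCompletion K) (ψm c) = EisensteinRoot.CoeffDisc.toF Dv c)
    [(E₀.map (Int.castRingHom ℚ_[p])).IsElliptic] [(E₀.map (Int.castRingHom (ZMod p))).IsElliptic]
    (em : W.tateModule p ≃ₗ[ℤ_[p]] AinfTop.TatePtO (v.adicCompletion K) (Wm.map ψm) p)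
    (hem : ∀ (σ : absoluteGaloisGroup (v.adicCompletion K)) (a : W.tateModule p), em (absGaloisRestrict K₀ (v.adicCompletion K) σ • a) = σ • em a)
    {N : ℕ} (hN : Dv.e ≤ N) {LT : AinfTop.TatePtO (v.adicCompletion K) (Wm.map ψm) p →+ BmaxPlus (v.adicCompletion K) p}
    {P₀ Q₀ Pω₀ Pη₀ : AinfTop.TatePtO (v.adicCompletion K) (Wm.map ψm) p →+ BdRPlusTop (v.adicCompletion K) p}
    (hLT : ∀ (τ : AinfTop.TatePtO (v.adicCompletion K) (Wm.map ψm) p) (w : ℕ → (maxNilIdealC (v.adicCompletion K)).toIdeal)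
        (hw : ∀ n, AinfTop.mulPC (v.adicCompletion K) p E₀ (w (n + 1)) = w n)
        (_ : ∀ n, ‖(((w n : (maxNilIdealC (v.adicCompletion K)).toIdeal) : CBall (v.adicCompletion K)) : CompletedAlgClosure (v.adicCompletion K)) -
          (((AinfTop.seqO (Wm.map ψm) τ n : (maxNilIdealC (v.adicCompletion K)).toIdeal) : CBall (v.adicCompletion K)) :
            CompletedAlgClosure (v.adicCompletion K))‖ ≤
          ‖((Dv.rootC : integerC (v.adicCompletion K)) : CompletedAlgClosure (v.adicCompletion K))‖)
        (z : bmaxZero (v.adicCompletion K) p), algebraMap (Ainf (p := p) (v.adicCompletion K)) (bmaxZero (v.adicCompletion K) p)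
          ((AinfTop.of (v.adicCompletion K) p).symm (((AinfTop.divisionLiftPt E₀ (surjective_fontaineTheta_integerC hpv) w hw).val :
            (AinfTop.nilTheta (v.adicCompletion K) p (surjective_fontaineTheta_integerC hpv)).toIdeal) : AinfTop (v.adicCompletion K) p)) ^ N =
          (p : bmaxZero (v.adicCompletion K) p) * z →
        LT τ = PadicLogSeries.logSum ((algebraMap (Ainf (p := p) (v.adicCompletion K)) (bmaxZero (v.adicCompletion K) p)).comp zpToAinf)
          (GaloisContinuity.formalLogNum E₀ p) N
          (algebraMap (Ainf (p := p) (v.adicCompletion K)) (bmaxZero (v.adicCompletion K) p)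
            ((AinfTop.of (v.adicCompletion K) p).symm (((AinfTop.divisionLiftPt E₀ (surjective_fontaineTheta_integerC hpv) w hw).val :
              (AinfTop.nilTheta (v.adicCompletion K) p (surjective_fontaineTheta_integerC hpv)).toIdeal) : AinfTop (v.adicCompletion K) p))) z)
    (hP₀ : ∀ τ, P₀ τ = BdRPlusTop.of (v.adicCompletion K) p (bmaxPlusToBdR (v.adicCompletion K) p (LT τ)))
    (hQ₀ : ∀ τ, Q₀ τ = BdRPlusTop.of (v.adicCompletion K) p (bmaxPlusToBdR (v.adicCompletion K) p (frobBmaxPlus (v.adicCompletion K) p (LT τ))))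
    (hP₀Z : ∀ (c : ℤ_[p]) (τ : AinfTop.TatePtO (v.adicCompletion K) (Wm.map ψm) p),
      P₀ (c • τ) = BdRPlusTop.of (v.adicCompletion K) p (qpToBdR (c : ℚ_[p])) * P₀ τ)
    (hQ₀Z : ∀ (c : ℤ_[p]) (τ : AinfTop.TatePtO (v.adicCompletion K) (Wm.map ψm) p),
      Q₀ (c • τ) = BdRPlusTop.of (v.adicCompletion K) p (qpToBdR (c : ℚ_[p])) * Q₀ τ)
    (hP₀g : ∀ (σ : absoluteGaloisGroup (v.adicCompletion K)) (τ : AinfTop.TatePtO (v.adicCompletion K) (Wm.map ψm) p),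
      BdRPlusTop.gal (v.adicCompletion K) p σ (P₀ τ) = P₀ (σ • τ))
    (hQ₀g : ∀ (σ : absoluteGaloisGroup (v.adicCompletion K)) (τ : AinfTop.TatePtO (v.adicCompletion K) (Wm.map ψm) p),
      BdRPlusTop.gal (v.adicCompletion K) p σ (Q₀ τ) = Q₀ (σ • τ))
    (A B C C' : v.adicCompletion K) (hAB : A ≠ 0 ∨ B ≠ 0)
    (hPω₀ : ∀ τ, Pω₀ τ = BdRPlusTop.of (v.adicCompletion K) p (embBdRHom hpv (surjective_fontaineTheta_integerC hpv) A) * P₀ τ +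
      BdRPlusTop.of (v.adicCompletion K) p (embBdRHom hpv (surjective_fontaineTheta_integerC hpv) B) * Q₀ τ)
    (hPη₀ : ∀ τ, Pη₀ τ = BdRPlusTop.of (v.adicCompletion K) p (embBdRHom hpv (surjective_fontaineTheta_integerC hpv) C) * P₀ τ +
      BdRPlusTop.of (v.adicCompletion K) p (embBdRHom hpv (surjective_fontaineTheta_integerC hpv) C') * Q₀ τ)
    (hfil₀ : ∀ τ, Pω₀ τ ∈ (BdRPlusTop.filOne (v.adicCompletion K) p).toIdeal) (hne₀ : ∃ τ, Pω₀ τ ≠ 0)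
    (hnot₀ : ∃ τ, Pη₀ τ ∉ (BdRPlusTop.filOne (v.adicCompletion K) p).toIdeal)
    (ψ : C(absoluteGaloisGroup (v.adicCompletion K), ℤ_[p])) (hψ : ∀ σ τ, ψ (σ * τ) = ψ σ + ψ τ)
    (hψlog : ∀ τ, (ψ τ : ℚ_[p]) = logCyclotomic (F := v.adicCompletion K) p τ)
    (heL : ∀ (c : ℤ_[p]) (S U : W.tateModule p), (weilContPairingPadic W (v.adicCompletion K) p e hμ hadd₁ hadd₂ hgal hcompat).toLin (c • S) U =
      twistHom (v.adicCompletion K) p ((weilContPairingPadic W (v.adicCompletion K) p e hμ hadd₁ hadd₂ hgal hcompat).toLin S U) c)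
    (healt : ∀ S : W.tateModule p, (weilContPairingPadic W (v.adicCompletion K) p e hμ hadd₁ hadd₂ hgal hcompat).toLin S S = 0)
    (henondeg : ∀ S : W.tateModule p,
      (∀ U, (weilContPairingPadic W (v.adicCompletion K) p e hμ hadd₁ hadd₂ hgal hcompat).toLin S U = 0) → S = 0)
    (hinj : letI := LocalField.padicAlgebra (v.adicCompletion K) p hpv
      (bdRPeriodRingData (F := v.adicCompletion K) (p := p) hpv).CupLogInjective (logCyclotomic p) (restrictedRationalTateRep W (v.adicCompletion K) p))
    (hde : letI := LocalField.padicAlgebra (v.adicCompletion K) p hpv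
      ∀ η : contOneCocycles (restrictedTateRep W (v.adicCompletion K) p).toTopRep,
        (bdRPeriodRingData (F := v.adicCompletion K) (p := p) hpv).HasDualExp (logCyclotomic p) (restrictedRationalTateRep W (v.adicCompletion K) p)
          fun σ => TateModule.toRational p (η.1 σ))
    (d : letI := LocalField.padicAlgebra (v.adicCompletion K) p hpv
      (bdRPeriodRingData (F := v.adicCompletion K) (p := p) hpv).FilZeroLine (restrictedRationalTateRep W (v.adicCompletion K) p)) :
    letI := LocalField.padicAlgebra (v.adicCompletion K) p hpv
    let hF := surjective_fontaineTheta_integerC hpv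
    let Pω : W.tateModule p →+ BdRPlusTop (v.adicCompletion K) p := Pω₀.comp em.toAddMonoidHom
    let Pη : W.tateModule p →+ BdRPlusTop (v.adicCompletion K) p := Pη₀.comp em.toAddMonoidHom
    let P₁ : W.tateModule p →+ BdRPlusTop (v.adicCompletion K) p := P₀.comp em.toAddMonoidHom
    let Q₁ : W.tateModule p →+ BdRPlusTop (v.adicCompletion K) p := Q₀.comp em.toAddMonoidHom
    ∃ (cL c : v.adicCompletion K), cL ≠ 0 ∧
      (∀ S U : W.tateModule p, Pω S * Pη U - Pη S * Pω U = BdRPlusTop.of (v.adicCompletion K) p (embBdRHom hpv hF cL) *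
        BdRPlusTop.periodLine (v.adicCompletion K) p ((weilContPairingPadic W (v.adicCompletion K) p e hμ hadd₁ hadd₂ hgal hcompat).toLin S U)) ∧
      ∀ (η κ : contOneCocycles (restrictedTateRep W (v.adicCompletion K) p).toTopRep) (P : (W.baseChange (v.adicCompletion K)).toAffine.Point),
        (∀ j, (cohomologyMap (tateProjMor W (v.adicCompletion K) p j) 1).hom (oneCocycleClass _ κ) = kummerLevelClass W (v.adicCompletion K) p j P) →
        ∀ (bω₀ bη₀ : BdRPlusTop (v.adicCompletion K) p) (cP : v.adicCompletion K),
          (∀ τ, P₁ (κ.1 τ) = BdRPlusTop.gal (v.adicCompletion K) p τ bω₀ - bω₀) →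
          (∀ τ, Q₁ (κ.1 τ) = BdRPlusTop.gal (v.adicCompletion K) p τ bη₀ - bη₀) →
          thetaBdR ((BdRPlusTop.of (v.adicCompletion K) p).symm
            (BdRPlusTop.of (v.adicCompletion K) p (embBdRHom hpv hF A) * bω₀ + BdRPlusTop.of (v.adicCompletion K) p (embBdRHom hpv hF B) * bη₀)) =
            algebraMap (v.adicCompletion K) (CompletedAlgClosure (v.adicCompletion K)) cP →
          ∀ {ι : Type} [Fintype ι] (b : Module.Basis ι ℤ_[p] (W.tateModule p)),
            (∀ i, ∃ M : ℕ, IsTeichLog 2 ((BdRPlusTop.of (v.adicCompletion K) p).symm ((p : BdRPlusTop (v.adicCompletion K) p) ^ M *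
              (Q₁ (b i) * bω₀ - P₁ (b i) * bη₀)))) →
            ((tatePairingPoint W (v.adicCompletion K) p e hμ hadd₁ hadd₂ hgal hcompat (oneCocycleClass _ η) P : ℤ_[p]) : ℚ_[p]) =
              -Algebra.trace ℚ_[p] (v.adicCompletion K) (cP * (expStarCoord W hpv d η * c)) := by
  intro hF Pω Pη P₁ Q₁
  have hPωapp : ∀ a, Pω a = Pω₀ (em a) := fun _ => rfl
  have hPηapp : ∀ a, Pη a = Pη₀ (em a) := fun _ => rfl
  -- names for the four scalars in `B_dR⁺` (no `set`: the context is large)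
  obtain ⟨ιA, hιA⟩ : ∃ x : BdRPlusTop (v.adicCompletion K) p, x = BdRPlusTop.of (v.adicCompletion K) p (embBdRHom hpv hF A) := ⟨_, rfl⟩
  obtain ⟨ιB, hιB⟩ : ∃ x : BdRPlusTop (v.adicCompletion K) p, x = BdRPlusTop.of (v.adicCompletion K) p (embBdRHom hpv hF B) := ⟨_, rfl⟩
  obtain ⟨ιC, hιC⟩ : ∃ x : BdRPlusTop (v.adicCompletion K) p, x = BdRPlusTop.of (v.adicCompletion K) p (embBdRHom hpv hF C) := ⟨_, rfl⟩
  obtain ⟨ιC', hιC'⟩ : ∃ x : BdRPlusTop (v.adicCompletion K) p, x = BdRPlusTop.of (v.adicCompletion K) p (embBdRHom hpv hF C') := ⟨_, rfl⟩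
  have hPω₀' : ∀ τ, Pω₀ τ = ιA * P₀ τ + ιB * Q₀ τ := fun τ => by rw [hιA, hιB]; exact hPω₀ τ
  have hPη₀' : ∀ τ, Pη₀ τ = ιC * P₀ τ + ιC' * Q₀ τ := fun τ => by rw [hιC, hιC']; exact hPη₀ τ
  have hgalA : ∀ σ : absoluteGaloisGroup (v.adicCompletion K), BdRPlusTop.gal (v.adicCompletion K) p σ ιA = ιA := fun σ => by
    rw [hιA, BdRPlusTop.gal_of, galBdRPlus_embBdRHom]
  have hgalB : ∀ σ : absoluteGaloisGroup (v.adicCompletion K), BdRPlusTop.gal (v.adicCompletion K) p σ ιB = ιB := fun σ => by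
    rw [hιB, BdRPlusTop.gal_of, galBdRPlus_embBdRHom]
  have hgalC : ∀ σ : absoluteGaloisGroup (v.adicCompletion K), BdRPlusTop.gal (v.adicCompletion K) p σ ιC = ιC := fun σ => by
    rw [hιC, BdRPlusTop.gal_of, galBdRPlus_embBdRHom]
  have hgalC' : ∀ σ : absoluteGaloisGroup (v.adicCompletion K), BdRPlusTop.gal (v.adicCompletion K) p σ ιC' = ιC' := fun σ => by
    rw [hιC', BdRPlusTop.gal_of, galBdRPlus_embBdRHom]
  -- the capstone's period-map hypotheses for the recombined pair
  have hPω₀Z : ∀ (c : ℤ_[p]) (τ : AinfTop.TatePtO (v.adicCompletion K) (Wm.map ψm) p),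
      Pω₀ (c • τ) = BdRPlusTop.of (v.adicCompletion K) p (qpToBdR (c : ℚ_[p])) * Pω₀ τ := fun c τ => by
    rw [hPω₀', hPω₀', hP₀Z, hQ₀Z]; ring
  have hPη₀Z : ∀ (c : ℤ_[p]) (τ : AinfTop.TatePtO (v.adicCompletion K) (Wm.map ψm) p),
      Pη₀ (c • τ) = BdRPlusTop.of (v.adicCompletion K) p (qpToBdR (c : ℚ_[p])) * Pη₀ τ := fun c τ => by
    rw [hPη₀', hPη₀', hP₀Z, hQ₀Z]; ring
  have hPω₀g : ∀ (σ : absoluteGaloisGroup (v.adicCompletion K)) (τ : AinfTop.TatePtO (v.adicCompletion K) (Wm.map ψm) p),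
      BdRPlusTop.gal (v.adicCompletion K) p σ (Pω₀ τ) = Pω₀ (σ • τ) := fun σ τ => by
    rw [hPω₀', hPω₀', map_add, map_mul, map_mul, hgalA, hgalB, hP₀g, hQ₀g]
  have hPη₀g : ∀ (σ : absoluteGaloisGroup (v.adicCompletion K)) (τ : AinfTop.TatePtO (v.adicCompletion K) (Wm.map ψm) p),
      BdRPlusTop.gal (v.adicCompletion K) p σ (Pη₀ τ) = Pη₀ (σ • τ) := fun σ τ => by
    rw [hPη₀', hPη₀', map_add, map_mul, map_mul, hgalC, hgalC', hP₀g, hQ₀g]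
  have hPωZ : ∀ (c : ℤ_[p]) (a : W.tateModule p), Pω (c • a) = BdRPlusTop.of (v.adicCompletion K) p (qpToBdR (c : ℚ_[p])) * Pω a :=
    fun c a => by rw [hPωapp, hPωapp, map_smul, hPω₀Z]
  have hPηZ : ∀ (c : ℤ_[p]) (a : W.tateModule p), Pη (c • a) = BdRPlusTop.of (v.adicCompletion K) p (qpToBdR (c : ℚ_[p])) * Pη a :=
    fun c a => by rw [hPηapp, hPηapp, map_smul, hPη₀Z]
  have hPωg : ∀ (σ : absoluteGaloisGroup (v.adicCompletion K)) (a : W.tateModule p),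
      BdRPlusTop.gal (v.adicCompletion K) p σ (Pω a) = Pω (restrictedTateRep W (v.adicCompletion K) p σ a) := fun σ a => by
    rw [hPωapp, hPωapp, hPω₀g, restrictedTateRep_apply_apply, hem]
  have hPηg : ∀ (σ : absoluteGaloisGroup (v.adicCompletion K)) (a : W.tateModule p),
      BdRPlusTop.gal (v.adicCompletion K) p σ (Pη a) = Pη (restrictedTateRep W (v.adicCompletion K) p σ a) := fun σ a => by
    rw [hPηapp, hPηapp, hPη₀g, restrictedTateRep_apply_apply, hem]
  have hfil : ∀ a, Pω a ∈ (BdRPlusTop.filOne (v.adicCompletion K) p).toIdeal := fun a => by rw [hPωapp]; exact hfil₀ _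
  have hne : ∃ a, Pω a ≠ 0 := by
    obtain ⟨τ, hτ⟩ := hne₀
    exact ⟨em.symm τ, by rwa [hPωapp, LinearEquiv.apply_symm_apply]⟩
  have hnot : ∃ a, Pη a ∉ (BdRPlusTop.filOne (v.adicCompletion K) p).toIdeal := by
    obtain ⟨τ, hτ⟩ := hnot₀
    exact ⟨em.symm τ, by rwa [hPηapp, LinearEquiv.apply_symm_apply]⟩
  obtain ⟨cL, c, hcL, hLeg, hmain⟩ := exists_const_tatePairingPoint_eq_neg_trace_of_KTwoBasis v W e hμ hadd₁ hadd₂ hgal hcompat hpv hF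
    ψ hψ hψlog hPωZ hPηZ hPωg hPηg hfil hne hnot heL healt henondeg hinj hde d
  refine ⟨cL, c, hcL, hLeg, fun η κ P hκ bω₀ bη₀ cP hbω₀ hbη₀ hθb ι _ b hK => ?_⟩
  -- `θ(P⁰ ∧ Q⁰) = 0` from `Pω″ ⊆ Fil¹`, `(A, B) ≠ 0`
  have hHL := thetaBdR_hodgeLine_of_filOne hpv hF P₀ Q₀ Pω₀ A B hPω₀ hfil₀
  have hab : algebraMap (v.adicCompletion K) (CompletedAlgClosure (v.adicCompletion K)) A ≠ 0 ∨
      algebraMap (v.adicCompletion K) (CompletedAlgClosure (v.adicCompletion K)) B ≠ 0 := by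
    rcases hAB with h | h
    · exact Or.inl fun h' => h ((algebraMap (v.adicCompletion K) (CompletedAlgClosure (v.adicCompletion K))).injective
        (by rw [h', map_zero]))
    · exact Or.inr fun h' => h ((algebraMap (v.adicCompletion K) (CompletedAlgClosure (v.adicCompletion K))).injective
        (by rw [h', map_zero]))
  -- `ι(c_L⁻¹·(AC′ − BC)) ∈ ℚ_p`: compare the capstone's Legendre relation with Fontaine's lemma at a Weil-nondegenerate pair `(a, U)`
  obtain ⟨a, ha⟩ := hne
  have ha0 : a ≠ 0 := fun h => ha (by rw [h, map_zero])
  obtain ⟨U, hU⟩ : ∃ U, (weilContPairingPadic W (v.adicCompletion K) p e hμ hadd₁ hadd₂ hgal hcompat).toLin a U ≠ 0 := by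
    by_contra h
    push Not at h
    exact ha0 (henondeg a h)
  have he0 : ((epsLineEquiv (v.adicCompletion K) p).symm
      ((weilContPairingPadic W (v.adicCompletion K) p e hμ hadd₁ hadd₂ hgal hcompat).toLin a U) : ℤ_[p]) ≠ 0 := fun h =>
    hU ((epsLineEquiv (v.adicCompletion K) p).symm.injective (by rw [h, map_zero]))
  have hθD : thetaBdR ((BdRPlusTop.of (v.adicCompletion K) p).symm (P₀ (em a) * Q₀ (em U) - Q₀ (em a) * P₀ (em U))) = 0 :=
    thetaBdR_transported_det_eq_zero_of_hodgeLine P₀ Q₀ hab hHL (em a) (em U)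
  obtain ⟨k, lam, hlam⟩ := exists_pow_mul_transported_det_eq_tBdR Dv Wm E₀ hWE ψm hψm (hθ := hF) hF hN hLT hP₀ hQ₀ (em a) (em U) hθD
  have hLaU := hLeg a U
  rw [hPωapp, hPωapp, hPηapp, hPηapp, hodgePair_det_eq P₀ Q₀ Pω₀ Pη₀ ιA ιB ιC ιC' hPω₀' hPη₀', BdRPlusTop.periodLine_apply] at hLaU
  obtain ⟨e₀, he₀⟩ : ∃ e₀ : ℤ_[p], ((epsLineEquiv (v.adicCompletion K) p).symm
      ((weilContPairingPadic W (v.adicCompletion K) p e hμ hadd₁ hadd₂ hgal hcompat).toLin a U) : ℤ_[p]) = e₀ := ⟨_, rfl⟩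
  rw [he₀] at hLaU he0
  haveI := isDomain_bDeRhamPlus hF
  haveI : IsDomain (BdRPlusTop (v.adicCompletion K) p) := isDomain_bDeRhamPlus hF
  -- the scalar `AC′ − BC` in `F` and in `B_dR⁺`
  have hιdet : ιA * ιC' - ιB * ιC = BdRPlusTop.of (v.adicCompletion K) p (embBdRHom hpv hF (A * C' - B * C)) := by
    rw [hιA, hιB, hιC, hιC', map_sub, map_mul, map_mul, map_sub, map_mul, map_mul]
  -- `ι(AC′ − BC)·c·t = ι(c_L)·(p^k e₀)·t`
  have hkey : embBdRHom hpv hF cL * qpToBdR ((((p : ℤ_[p]) ^ k * e₀ : ℤ_[p]) : ℚ_[p])) =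
      embBdRHom hpv hF (A * C' - B * C) * qpToBdR (lam : ℚ_[p]) := by
    apply mul_right_cancel₀ (tBdR_ne_zero hF)
    apply (BdRPlusTop.of (v.adicCompletion K) p).injective
    have h2 : (ιA * ιC' - ιB * ιC) * ((p : BdRPlusTop (v.adicCompletion K) p) ^ k * (P₀ (em a) * Q₀ (em U) - Q₀ (em a) * P₀ (em U))) =
        (p : BdRPlusTop (v.adicCompletion K) p) ^ k * (BdRPlusTop.of (v.adicCompletion K) p (embBdRHom hpv hF cL) *
          BdRPlusTop.of (v.adicCompletion K) p (qpToBdR (e₀ : ℚ_[p]) * tBdR)) := by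
      rw [← hLaU]; ring
    rw [hlam, hιdet] at h2
    simp only [map_mul, map_pow, map_natCast, PadicInt.coe_mul, PadicInt.coe_pow, PadicInt.coe_natCast] at h2 ⊢
    linear_combination -h2
  have hdet0 : A * C' - B * C ≠ 0 := by
    intro h0
    rw [h0, map_zero, zero_mul, mul_eq_zero, map_eq_zero_iff _ (embBdRHom_injective hpv hF),
      map_eq_zero_iff _ (qpToBdR (F := v.adicCompletion K) (p := p)).injective, PadicInt.coe_eq_zero, mul_eq_zero] at hkey
    rcases hkey with h | h | h
    · exact hcL h
    · exact pow_ne_zero k (Nat.cast_ne_zero.2 (Fact.out : p.Prime).ne_zero) h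
    · exact he0 h
  have hlam0 : lam ≠ 0 := by
    rintro rfl
    rw [PadicInt.coe_zero, map_zero, mul_zero, mul_eq_zero, map_eq_zero_iff _ (embBdRHom_injective hpv hF),
      map_eq_zero_iff _ (qpToBdR (F := v.adicCompletion K) (p := p)).injective, PadicInt.coe_eq_zero, mul_eq_zero] at hkey
    rcases hkey with h | h | h
    · exact hcL h
    · exact pow_ne_zero k (Nat.cast_ne_zero.2 (Fact.out : p.Prime).ne_zero) h
    · exact he0 h
  -- `ι(c_L⁻¹·(AC′ − BC)) = q ∈ ℚ_p` with `p^{m₀} q ∈ ℤ_p`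
  obtain ⟨q, hqdef⟩ : ∃ q : ℚ_[p], q = (((p : ℤ_[p]) ^ k * e₀ : ℤ_[p]) : ℚ_[p]) / (lam : ℚ_[p]) := ⟨_, rfl⟩
  have hr : embBdRHom hpv hF (cL⁻¹ * (A * C' - B * C)) = qpToBdR q := by
    have hlamQ : (lam : ℚ_[p]) ≠ 0 := by rw [Ne, PadicInt.coe_eq_zero]; exact hlam0
    have h1 : embBdRHom hpv hF cL⁻¹ * embBdRHom hpv hF cL = 1 := by rw [← map_mul, inv_mul_cancel₀ hcL, map_one]
    have h3 : qpToBdR (F := v.adicCompletion K) (p := p) (lam : ℚ_[p]) * qpToBdR ((lam : ℚ_[p])⁻¹) = 1 := by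
      rw [← map_mul, mul_inv_cancel₀ hlamQ, map_one]
    have h4 : qpToBdR (F := v.adicCompletion K) (p := p) q =
        qpToBdR ((((p : ℤ_[p]) ^ k * e₀ : ℤ_[p]) : ℚ_[p])) * qpToBdR ((lam : ℚ_[p])⁻¹) := by
      rw [← map_mul, hqdef, div_eq_mul_inv]
    rw [map_mul]
    linear_combination (-(embBdRHom hpv hF cL⁻¹ * qpToBdR ((lam : ℚ_[p])⁻¹))) * hkey -
      (embBdRHom hpv hF cL⁻¹ * embBdRHom hpv hF (A * C' - B * C)) * h3 +
      (qpToBdR (F := v.adicCompletion K) (p := p) ((((p : ℤ_[p]) ^ k * e₀ : ℤ_[p]) : ℚ_[p])) * qpToBdR ((lam : ℚ_[p])⁻¹)) * h1 - h4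
  obtain ⟨m₀, b₀, hb₀⟩ := AinfTop.exists_pow_mul_div_eq_coe (p := p) ((p : ℤ_[p]) ^ k * e₀) lam hlam0
  rw [← hqdef] at hb₀
  -- `ι(q) = ι(c_L⁻¹)·(ι(A)ι(C′) − ι(B)ι(C))` in `B_dR⁺`
  have hq' : BdRPlusTop.of (v.adicCompletion K) p (qpToBdR q) =
      BdRPlusTop.of (v.adicCompletion K) p (embBdRHom hpv hF cL⁻¹) * (ιA * ιC' - ιB * ιC) := by
    rw [hιdet, ← map_mul, ← map_mul, hr]
  -- the recombined pair through the pull-backs `P₁ = P⁰∘em`, `Q₁ = Q⁰∘em` (stated for a GENERIC argument: unfolding the compositions at the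
  -- cocycle values directly runs into prohibitively slow failing unifications `T_pW =?= T_pŴ_D`)
  have hPωdec : ∀ x, Pω x = ιA * P₁ x + ιB * Q₁ x := fun x => by
    show Pω₀ (em x) = ιA * P₀ (em x) + ιB * Q₀ (em x)
    exact hPω₀' (em x)
  have hPηdec : ∀ x, Pη x = ιC * P₁ x + ιC' * Q₁ x := fun x => by
    show Pη₀ (em x) = ιC * P₀ (em x) + ιC' * Q₀ (em x)
    exact hPη₀' (em x)
  -- the crystalline (K₂) ⟹ the capstone's rescaled basis form, at ONE exponent
  have hX := AinfTop.exists_forall_isTeichLog_pow_mul_qpToBdR_mul (F := v.adicCompletion K) (k := 2) hb₀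
    (X := fun i => Q₁ (b i) * bω₀ - P₁ (b i) * bη₀) hK
  refine hX.elim fun N' hN' => ?_
  -- the recombined integrating pair `b″_ω = ι(A)b⁰_ω + ι(B)b⁰_η`, `b″_η = ι(C)b⁰_ω + ι(C′)b⁰_η`
  refine hmain η κ P hκ (ιA * bω₀ + ιB * bη₀) (ιC * bω₀ + ιC' * bη₀) cP (fun τ => ?_) (fun τ => ?_) ?_ N' b fun i => ?_
  · rw [hPωdec, hbω₀ τ, hbη₀ τ, map_add, map_mul, map_mul, hgalA, hgalB]; ring
  · rw [hPηdec, hbω₀ τ, hbη₀ τ, map_add, map_mul, map_mul, hgalC, hgalC']; ring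
  · rw [hιA, hιB]; exact hθb
  have h := hN' i
  have heq : BdRPlusTop.of (v.adicCompletion K) p (embBdRHom hpv hF cL⁻¹) * Pη (b i) * (ιA * bω₀ + ιB * bη₀) -
      Pω (b i) * (BdRPlusTop.of (v.adicCompletion K) p (embBdRHom hpv hF cL⁻¹) * (ιC * bω₀ + ιC' * bη₀)) =
      BdRPlusTop.of (v.adicCompletion K) p (qpToBdR q) * (Q₁ (b i) * bω₀ - P₁ (b i) * bη₀) := by
    rw [hPωdec, hPηdec, hq']; ring
  rw [heq]
  exact h

end Completion

end Literature.NumberTheory.PAdicHodge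

end
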